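import Literature.NumberTheory.Li1992.RallisRankOneContCM
import Literature.NumberTheory.GelbartRogawski1991.UnitaryDualPairCMLineTorus
import Literature.NumberTheory.GelbartRogawski1991.UnitaryDualPairThetaLiftGaussianCMLine
import Literature.MeasureTheory.Group.CosetSpaceLpTransport
import Summits.HodgeConjecture.HodgeCM.Model.AdelicThetaDistribution
import Summits.HodgeConjecture.HodgeCM.Model.WmInstanceV2
import Summits.HodgeConjecture.HodgeCM.Model.ArchSideTerm
import HarnessLib

/-!
# FLOOR-0 P4, S4b — S6 AT THE PIN: Rallis' identity (26) for `cmThetaKernelDatum … (frameD V) … ⟨a⟩ … hGR₀` against THE pin measure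
# `(cosetCongr e)_* (Haar probability of [U(1)])`, from the letter `Li1992.RallisInnerProductFormulaUnitaryDualPairRankOneCont`

Cell hodgecm-mathlib (D-0151), FLOOR 0, crux item H413 = stmt-HodgeConjecture-24833; programme P4, line
`Cruxes/H413/Lines/F0_P4AdmissibleOccursInH1.lean` ED. 3.1′, stub S4b `stub_T3a_holThetaAtAdmissibleLineOfRallisAt` (its ANTECEDENT is the
letter; lead∕assembler F0P4-p01, (N)-row F0P4-p02∕p05).  Author F0P4-p05 (g2); RE-CUT over LETTER ED. 4 (`hF` binder) by F0P4-p04 (g3)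
(F0P4-plan (g4) 2026-08-31T03:05:56Z ∕ 03:20:18Z; the `…ContCM` theorem gains the explicit pin hypothesis `hFpin`, nothing else changes).
`--supports stmt-HodgeConjecture-24833` (helper).  DEF-FREE.
Namespace `Summit.HodgeConjecture.HodgeConjecture.Cruxes.H413.ThetaNonvanishing`.

THE POINT.  The (26)-assembly ★ `ThetaNonvanishing.dist_ne_zero_of_rallis_of_eigen_of_finCoeff` (p795212) and the `hne` bridge ★
`RallisTransport.exists_dist_ne_zero_of_pin_thetaLift_ne_zero` (p796018, through ★ brick 7) take Rallis' identity INSTANTIATED: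
`hR : (cmThetaKernelDatum (L : Type) e₁ (frameD V) … (lineVec a) … hGR₀ hρ SK hSK).RallisInnerProductIdentity (schwartzPairing νX) dh μ′ ν` with
`μ′ := (probHaarRelNormOneQuot L⁺ L).map (cosetCongr (cmLineTorusEquiv a) …)` — the Haar probability measure of the model's `[U(1)] =
E¹(𝔸)∕E¹(L⁺)` carried to S6's `[U(⟨a⟩)]` along ★ `cmLineTorusEquiv` (J-R transport ★ `kernelDatum_thetaLift_ne_zero_iff_canonical`).  ★
`Li1992.rallisInnerProductIdentity_cm_of_rankOneCont` (FILE 1, generic CM pair) discharges the letter's seven structural binders; THIS file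
discharges, at the pin `(frameD V, ⟨a⟩)`, the remaining ones that do not depend on the assembler's choices:

* the Picard-type signs of `frameD V` (★ `frameD_sign_ι₁'`, `frameD_sign_of_ne`) feeding `hcoef`;
* `[U(⟨a⟩)]` compact (★ `compactSpace_quotient_range_toAdelic_line`);
* the THREE properties of the pin measure `μ′` the letter asks for: finite (push-forward of a probability measure), charging open sets (★
  `isOpenPosMeasure_map_cosetCongr`, `e` a homeomorphism: ★ `continuous_cmLineTorusEquiv(_symm)`), and `U(⟨a⟩)(𝔸)`-INVARIANT (★
  `smulInvariantMeasure_map_cosetCongr_of_smulInvariantMeasure` over the model's ★ instance `smulInvariantMeasure_probHaarRelNormOneQuot`);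
* the range `2 < 3`.

Results: `isFiniteMeasure_pinMeasure` ∕ `isOpenPosMeasure_pinMeasure` ∕ `smulInvariantMeasure_pinMeasure` (the three instances, stated as
theorems for the assembler's `haveI`), **`rallisInnerProductIdentity_pin_of_rankOneCont`** — `hR` at the pin from the letter — and
**`rallisInnerProductIdentity_pin_of_rankOneContCM`** — the same from the CM-RESTRICTED letter `…RankOneContCM` (★ `RallisKernelIdentity` ED. 3 §5, the
S6 antecedent of the P4 line from ED. 3.3) given a definite complex embedding `(τ, hτ)` of `diag (frameD V)` (★ `exists_ne_and_posDef_diagonal_frameD_map`)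
and the LETTER ED. 4 binder `hFpin` (finite-adelic integrability of the matrix coefficients of `ω_f ∘ s_pair` at `s := splittingOf hGR₀`; at the pin ★-track
`ThetaNonvanishing.hF_cm_splittingOf (h3 := le_refl 3) hGR₀`, A-p13 (g22)), for ANY additive
Haar `νX` on `𝔸_{L⁺}³`, ANY Haar `dh` on `U(⟨a⟩)(𝔸_{L⁺})`, ANY finite invariant open-positive `ν` on the compact `[U(diag frameD V)]` (all three are
integrated out by the consumers); `[U(V)]`-compactness stays an instance binder exactly as in the consumers (at the pin it is ★
`compactSpace_quotient_range_toAdelic_of_four_le_finrank (L : Type) ι₁ (frameD V) (frameD_real V) (frameD_sign_of_ne V) h4`, `4 ≤ [L:ℚ]`;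
the letter's `RallisInnerProductIdentity` itself is stated under it).
Conditional on the letter (`hR`).  HC_CM is proved only modulo the printed citations until rung 0 closes; this file proves nothing about them.

## References (conventions only; nothing of print is asserted)
* [Li1992] J.-S. Li, J. reine angew. Math. 428 (1992), Thm 2.1 (26) p. 184, p. 178.
* [GelbartRogawski1991] S. Gelbart, J. Rogawski, Invent. Math. 105 (1991), §3.1 Prop. 3.1.1 p. 455, Remark p. 457 L4–13.
* [Liu2021] Y. Liu, Camb. J. Math. 9 (2021), proof of Prop. 4.13 (l. 2145).
-/

set_option autoImplicit false
set_option linter.dupNamespace false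

noncomputable section

open _root_.MeasureTheory _root_.MeasureTheory.Measure
open NumberField hiding relNormOneIdeles relNormOneRat probHaarRelNormOneQuot
open scoped Matrix
open Literature.NumberTheory.Automorphic Literature.NumberTheory.Automorphic.UnitaryGroup Literature.NumberTheory.Weil1964
open Literature.NumberTheory.Li1992
open Literature.NumberTheory.GelbartRogawski1991 Literature.NumberTheory.GelbartRogawski1991.UnitaryDualPair
open Literature.MeasureTheory.Group
open HodgeCM HodgeCM.Adelic HodgeCM.PerL34 HodgeCM.Model HodgeCM.Model.ArchSideTerm

namespace Summit.HodgeConjecture.HodgeConjecture.Cruxes.H413.ThetaNonvanishing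

variable {L : CMField} {ι₁ : L →+* ℂ} (V : HermSpace3 L ι₁)
  (a : (L : Type)) (ha : IsCMField.complexConj L a = a) (ha0 : a ≠ 0)

/-! ## §1 The pin measure `μ′ = (cosetCongr e)_* probHaar` on `[U(⟨a⟩)]`: finite, open-positive, invariant -/

section PinMeasure

variable [MeasurableSpace (CMAdelic (L : Type) (lineVec (L : Type) a) ⧸ CMRat (L : Type) (lineVec (L : Type) a))]
  [BorelSpace (CMAdelic (L : Type) (lineVec (L : Type) a) ⧸ CMRat (L : Type) (lineVec (L : Type) a))]

omit [BorelSpace (CMAdelic (L : Type) (lineVec (L : Type) a) ⧸ CMRat (L : Type) (lineVec (L : Type) a))] in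
/-- the pin measure is finite (push-forward of the Haar PROBABILITY measure of `[U(1)]`). [cite: Li1992, p. 178] -/
theorem isFiniteMeasure_pinMeasure :
    IsFiniteMeasure ((probHaarRelNormOneQuot (↥(maximalRealSubfield L)) (L : Type)).map
      (cosetCongr (cmLineTorusEquiv (L : Type) a ha0) (relNormOneRat (↥(maximalRealSubfield L)) L)
        (CMRat (L : Type) (lineVec (L : Type) a)) (cmLineTorusEquiv_mem_CMRat_iff (L : Type) a ha0))) :=
  inferInstance

/-- the pin measure charges open sets (`cosetCongr e` is a homeomorphism). [cite: Li1992, p. 178] -/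
theorem isOpenPosMeasure_pinMeasure :
    ((probHaarRelNormOneQuot (↥(maximalRealSubfield L)) (L : Type)).map
      (cosetCongr (cmLineTorusEquiv (L : Type) a ha0) (relNormOneRat (↥(maximalRealSubfield L)) L)
        (CMRat (L : Type) (lineVec (L : Type) a)) (cmLineTorusEquiv_mem_CMRat_iff (L : Type) a ha0))).IsOpenPosMeasure :=
  isOpenPosMeasure_map_cosetCongr _ _ _ _ (continuous_cmLineTorusEquiv (L : Type) a ha0)
    (continuous_cmLineTorusEquiv_symm (L : Type) a ha0) _

/-- the pin measure is `U(⟨a⟩)(𝔸_{L⁺})`-INVARIANT (the Haar probability measure of the compact group `[U(1)]` is translation invariant, ★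
`smulInvariantMeasure_probHaarRelNormOneQuot`, and `cosetCongr e` is `e`-equivariant). [cite: Li1992, p. 178; GelbartRogawski1991, §3.1 Remark p. 457 L4–13] -/
theorem smulInvariantMeasure_pinMeasure :
    SMulInvariantMeasure (CMAdelic (L : Type) (lineVec (L : Type) a))
      (CMAdelic (L : Type) (lineVec (L : Type) a) ⧸ CMRat (L : Type) (lineVec (L : Type) a))
      ((probHaarRelNormOneQuot (↥(maximalRealSubfield L)) (L : Type)).map
        (cosetCongr (cmLineTorusEquiv (L : Type) a ha0) (relNormOneRat (↥(maximalRealSubfield L)) L)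
          (CMRat (L : Type) (lineVec (L : Type) a)) (cmLineTorusEquiv_mem_CMRat_iff (L : Type) a ha0))) :=
  smulInvariantMeasure_map_cosetCongr_of_smulInvariantMeasure _ _ _ _ (continuous_cmLineTorusEquiv (L : Type) a ha0) _

end PinMeasure

/-! ## §2 S6 at the pin -/

section AtPin

variable
  (hGR₀ : (cmSplittingDatum (L : Type) (e₁) (frameD V) (frameD_real V) (frameD_ne V) (lineVec (L : Type) a)
    (fun _ => ha) (fun _ => ha0)).CompatibleSplitting)
  (hρ : HasThetaMajorants fun
    (p : CMAdelic (L : Type) (frameD V) × CMAdelic (L : Type) (lineVec (L : Type) a))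
    (Φ : piSchwartzBruhat (↥(maximalRealSubfield L)) (Fin 3)) =>
      cmPairRep (L : Type) e₁ (frameD V) (frameD_real V) (frameD_ne V) (lineVec (L : Type) a)
        (fun _ => ha) (fun _ => ha0) hGR₀ p Φ)
  (SK : Set (piSchwartzBruhat (↥(maximalRealSubfield L)) (Fin 3)))
  (hSK : ∀ (h : CMAdelic (L : Type) (lineVec (L : Type) a)) (Φ : piSchwartzBruhat (↥(maximalRealSubfield L)) (Fin 3)),
    Φ ∈ SK → cmPairRep (L : Type) e₁ (frameD V) (frameD_real V) (frameD_ne V) (lineVec (L : Type) a)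
      (fun _ => ha) (fun _ => ha0) hGR₀ (1, h) Φ ∈ SK)
  [MeasurableSpace (AdeleRing (𝓞 ↥(maximalRealSubfield L)) ↥(maximalRealSubfield L))]
  [BorelSpace (AdeleRing (𝓞 ↥(maximalRealSubfield L)) ↥(maximalRealSubfield L))]
  (νX : Measure (Fin 3 → AdeleRing (𝓞 ↥(maximalRealSubfield L)) ↥(maximalRealSubfield L))) [νX.IsAddHaarMeasure]
  [MeasurableSpace (CMAdelic (L : Type) (lineVec (L : Type) a))] [BorelSpace (CMAdelic (L : Type) (lineVec (L : Type) a))]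
  (dh : Measure (CMAdelic (L : Type) (lineVec (L : Type) a))) [dh.IsHaarMeasure]
  [MeasurableSpace (CMAdelic (L : Type) (lineVec (L : Type) a) ⧸ CMRat (L : Type) (lineVec (L : Type) a))]
  [BorelSpace (CMAdelic (L : Type) (lineVec (L : Type) a) ⧸ CMRat (L : Type) (lineVec (L : Type) a))]
  [MeasurableSpace (CMAdelic (L : Type) (frameD V) ⧸ CMRat (L : Type) (frameD V))]
  [BorelSpace (CMAdelic (L : Type) (frameD V) ⧸ CMRat (L : Type) (frameD V))]
  (ν : Measure (CMAdelic (L : Type) (frameD V) ⧸ CMRat (L : Type) (frameD V))) [IsFiniteMeasure ν] [ν.IsOpenPosMeasure]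
  [SMulInvariantMeasure (CMAdelic (L : Type) (frameD V)) (CMAdelic (L : Type) (frameD V) ⧸ CMRat (L : Type) (frameD V)) ν]

/-- **S6 AT THE PIN, `[U(V)]`-COMPACTNESS AS A BINDER.**  Rallis' identity (26) for `cmThetaKernelDatum … (frameD V) … ⟨a⟩ … hGR₀ hρ SK hSK`, the
pairing `⟨·,·⟩_{νX}`, any Haar `dh` on `U(⟨a⟩)(𝔸_{L⁺})`, THE pin measure `(cosetCongr e)_* probHaar` on `[U(⟨a⟩)]` and any finite invariant
open-positive `ν` on the compact `[U(diag frameD V)]` — the `hR` binder of ★ `dist_ne_zero_of_rallis_of_eigen_of_finCoeff` ∕ ★ brick 7, token for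
token — FROM the letter `hR`. [cite: Li1992, Thm 2.1 (26) p. 184] [cite: GelbartRogawski1991, §3.1 Prop. 3.1.1 p. 455] -/
theorem rallisInnerProductIdentity_pin_of_rankOneCont [CompactSpace (CMAdelic (L : Type) (frameD V) ⧸ CMRat (L : Type) (frameD V))]
    (hR : RallisInnerProductFormulaUnitaryDualPairRankOneCont) :
    (cmThetaKernelDatum (L : Type) e₁ (frameD V) (frameD_real V) (frameD_ne V) (lineVec (L : Type) a)
        (fun _ => ha) (fun _ => ha0) hGR₀ hρ SK hSK).RallisInnerProductIdentity
      (schwartzPairing (↥(maximalRealSubfield L)) (Fin 3) νX) dh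
      ((probHaarRelNormOneQuot (↥(maximalRealSubfield L)) (L : Type)).map
        (cosetCongr (cmLineTorusEquiv (L : Type) a ha0) (relNormOneRat (↥(maximalRealSubfield L)) L)
          (CMRat (L : Type) (lineVec (L : Type) a)) (cmLineTorusEquiv_mem_CMRat_iff (L : Type) a ha0)))
      ν := by
  haveI : CompactSpace (CMAdelic (L : Type) (lineVec (L : Type) a) ⧸ CMRat (L : Type) (lineVec (L : Type) a)) :=
    compactSpace_quotient_range_toAdelic_line (L : Type) (lineVec (L : Type) a) (fun _ => ha) (fun _ => ha0)
  haveI := isFiniteMeasure_pinMeasure a ha0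
  haveI := isOpenPosMeasure_pinMeasure a ha0
  haveI := smulInvariantMeasure_pinMeasure a ha0
  exact rallisInnerProductIdentity_cm_of_rankOneCont (L : Type) e₁ (frameD V) (frameD_real V) (frameD_ne V)
    (lineVec (L : Type) a) (fun _ => ha) (fun _ => ha0) ι₁ hGR₀ (frameD_sign_ι₁' V) (frameD_sign_of_ne V) hρ SK hSK νX dh _ ν
    hR (by norm_num)

-- `Matrix.PosDef` over `ℂ` is stated for Mathlib's scoped partial order on `ℂ` (as in the letter's §5); `conj = starRingEnd ℂ`.
open scoped ComplexOrder ComplexConjugate in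
/-- **S6 AT THE PIN FROM THE CM-RESTRICTED LETTER** (`…RankOneContCM`, the P4 line's S6 antecedent from ED. 3.3): as
`rallisInnerProductIdentity_pin_of_rankOneCont`, given a complex embedding `τ` at which `diag (frameD V)` is positive definite (at the pin ★
`exists_ne_and_posDef_diagonal_frameD_map`, any `τ` off the place of `ι₁`, `4 ≤ [L:ℚ]`) and the LETTER ED. 4 pin hypothesis `hFpin` (finite-adelic integrability of the
matrix coefficients of `ω_f ∘ s_pair`, `s := splittingOf hGR₀`; ★-track `ThetaNonvanishing.hF_cm_splittingOf (h3 := le_refl 3) hGR₀`); `IsTotallyReal L⁺`, `IsTotallyComplex L`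
are instances. [cite: Li1992, Thm 2.1 (26) p. 184] [cite: GelbartRogawski1991, §3.1 Prop. 3.1.1 p. 455] -/
theorem rallisInnerProductIdentity_pin_of_rankOneContCM [CompactSpace (CMAdelic (L : Type) (frameD V) ⧸ CMRat (L : Type) (frameD V))]
    (hR : RallisInnerProductFormulaUnitaryDualPairRankOneContCM)
    (τ : (L : Type) →+* ℂ) (hτ : ((Matrix.diagonal (frameD V)).map τ).PosDef)
    (hFpin : ∀ [MeasurableSpace (IsDedekindDomain.FiniteAdeleRing (𝓞 ↥(maximalRealSubfield L)) ↥(maximalRealSubfield L))]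
      [BorelSpace (IsDedekindDomain.FiniteAdeleRing (𝓞 ↥(maximalRealSubfield L)) ↥(maximalRealSubfield L))]
      (μf : Measure (Fin 3 → IsDedekindDomain.FiniteAdeleRing (𝓞 ↥(maximalRealSubfield L)) ↥(maximalRealSubfield L))) [μf.IsAddHaarMeasure]
      [MeasurableSpace (UnitaryGroup.finAdelic (↥(maximalRealSubfield L)) (L : Type) (IsCMField.complexConj L) 1 (Matrix.diagonal (lineVec (L : Type) a)))]
      [BorelSpace (UnitaryGroup.finAdelic (↥(maximalRealSubfield L)) (L : Type) (IsCMField.complexConj L) 1 (Matrix.diagonal (lineVec (L : Type) a)))]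
      (μb : Measure (UnitaryGroup.finAdelic (↥(maximalRealSubfield L)) (L : Type) (IsCMField.complexConj L) 1 (Matrix.diagonal (lineVec (L : Type) a))))
      [μb.IsHaarMeasure] (Φf Ψf : FinSB (↥(maximalRealSubfield L)) (Fin 3)),
      Integrable (fun b : UnitaryGroup.finAdelic (↥(maximalRealSubfield L)) (L : Type) (IsCMField.complexConj L) 1 (Matrix.diagonal (lineVec (L : Type) a)) =>
        ∫ y, ((finSBReindex (↥(maximalRealSubfield L)) e₁ (UnitaryDualPair.WeilCoinv.finPairRep (↥(maximalRealSubfield L)) (L : Type)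
            (IsCMField.complexConj L) 3 1 e₁ (Matrix.diagonal (frameD V)) (Matrix.diagonal (lineVec (L : Type) a)) (complexConj_imagUnit (L : Type))
            (imagUnit_ne_zero (L : Type)) (imagUnit_mul_self (L : Type)) (realDiagonal_isSymm (L : Type) (frameD V) (frameD_real V))
            (realDiagonal_isSymm (L : Type) (lineVec (L : Type) a) (fun _ => ha)) (isUnit_det_realDiagonal (L : Type) (frameD V) (frameD_real V) (frameD_ne V))
            (isUnit_det_realDiagonal (L : Type) (lineVec (L : Type) a) (fun _ => ha) (fun _ => ha0)) (realDiagonal_map (L : Type) (frameD V) (frameD_real V)).symm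
            (realDiagonal_map (L : Type) (lineVec (L : Type) a) (fun _ => ha)).symm
            (splittingOf_isCompatible (↥(maximalRealSubfield L)) (L : Type) (IsCMField.complexConj L) 3 1 e₁ (Matrix.diagonal (frameD V))
              (Matrix.diagonal (lineVec (L : Type) a)) (complexConj_imagUnit (L : Type)) (imagUnit_ne_zero (L : Type)) (imagUnit_mul_self (L : Type))
              (realDiagonal_isSymm (L : Type) (frameD V) (frameD_real V)) (realDiagonal_isSymm (L : Type) (lineVec (L : Type) a) (fun _ => ha))
              (isUnit_det_realDiagonal (L : Type) (frameD V) (frameD_real V) (frameD_ne V))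
              (isUnit_det_realDiagonal (L : Type) (lineVec (L : Type) a) (fun _ => ha) (fun _ => ha0))
              (realDiagonal_map (L : Type) (frameD V) (frameD_real V)).symm (realDiagonal_map (L : Type) (lineVec (L : Type) a) (fun _ => ha)).symm hGR₀) (1, b)
            ((finSBReindex (↥(maximalRealSubfield L)) e₁).symm Φf)) : FinSB (↥(maximalRealSubfield L)) (Fin 3)) :
              (Fin 3 → IsDedekindDomain.FiniteAdeleRing (𝓞 ↥(maximalRealSubfield L)) ↥(maximalRealSubfield L)) → ℂ) y *
          conj ((Ψf : (Fin 3 → IsDedekindDomain.FiniteAdeleRing (𝓞 ↥(maximalRealSubfield L)) ↥(maximalRealSubfield L)) → ℂ) y) ∂μf) μb) :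
    (cmThetaKernelDatum (L : Type) e₁ (frameD V) (frameD_real V) (frameD_ne V) (lineVec (L : Type) a)
        (fun _ => ha) (fun _ => ha0) hGR₀ hρ SK hSK).RallisInnerProductIdentity
      (schwartzPairing (↥(maximalRealSubfield L)) (Fin 3) νX) dh
      ((probHaarRelNormOneQuot (↥(maximalRealSubfield L)) (L : Type)).map
        (cosetCongr (cmLineTorusEquiv (L : Type) a ha0) (relNormOneRat (↥(maximalRealSubfield L)) L)
          (CMRat (L : Type) (lineVec (L : Type) a)) (cmLineTorusEquiv_mem_CMRat_iff (L : Type) a ha0)))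
      ν := by
  haveI : CompactSpace (CMAdelic (L : Type) (lineVec (L : Type) a) ⧸ CMRat (L : Type) (lineVec (L : Type) a)) :=
    compactSpace_quotient_range_toAdelic_line (L : Type) (lineVec (L : Type) a) (fun _ => ha) (fun _ => ha0)
  haveI := isFiniteMeasure_pinMeasure a ha0
  haveI := isOpenPosMeasure_pinMeasure a ha0
  haveI := smulInvariantMeasure_pinMeasure a ha0
  exact rallisInnerProductIdentity_cm_of_rankOneContCM (L : Type) e₁ (frameD V) (frameD_real V) (frameD_ne V)
    (lineVec (L : Type) a) (fun _ => ha) (fun _ => ha0) ι₁ hGR₀ (frameD_sign_ι₁' V) (frameD_sign_of_ne V) hρ SK hSK νX dh _ ν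
    hR τ hτ (fun μf _ _ _ μb _ Φf Ψf => hFpin μf μb Φf Ψf) (by norm_num)


end AtPin

end Summit.HodgeConjecture.HodgeConjecture.Cruxes.H413.ThetaNonvanishing

end
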